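import Literature.MathematicalPhysics.QuantumFieldTheory.Balaban1983to89.B9Eq330HessianCovariance
import Literature.MathematicalPhysics.QuantumFieldTheory.Balaban1983to89.B5Eq172FlatFibreNaturality
import Literature.MathematicalPhysics.QuantumFieldTheory.Balaban1983to89.B9Eq332FieldAvgCovariance
import Literature.MathematicalPhysics.QuantumFieldTheory.Balaban1983to89.B5Eq155FlatAveragingCommute

/-!
# `Balaban1983to89.B9Eq333ProjectionCovariance` — T. Bałaban, *Propagators for lattice gauge theories in a background field*, Commun. Math.
# Phys. **99** (1985) 389–434 [Balaban1985BackgroundPropagators] (3.32)–(3.33) pp. 395–396 and *«the equalities (3.32) hold again»* (p. 396) ON THE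
# pub-balaban NE9 CHAIN'S CARRIERS: the averaging `Q′(U)` of the gauge parameters (`B9Eq326OperatorAssembly.QprimeW`), the projection `R(U)` onto
# `Δ^η_U N(Q′(U))` (`B9Eq326OperatorAssembly.RofU`) and the one-step vector averaging `Q(U)` of the periodic lattice (`B9Eq315QTorus.QtorusW`) are
# gauge covariant — `Q′(U^u)R(u) = R(u₁)Q′(U)`, `R(U^u)R(u) = R(u)R(U)`, `Q(U^u)R(u) = R(u₁)Q(U)` with `u₁(y) = u(L·y)` the gauge function at the block
# centres

statement-level skeleton of published theorems with citation tags; proofs where landed; nothing here is a claim about the Yang–Mills mass gap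

PDF held: `paper:balaban1985-cmp99-background-propagators` (journal page = PDF page + 388), pp. 395–396 read by this seat (2026-08-22, text layer).

THE PRINT (verbatim, pp. 395–396).  *«The matrices in the definitions (3.19) transform as follows R(U^u(Γ^{(j)}_{y,x})) = R(u(y))R(U(Γ^{(j)}_{y,x}))R(u⁻¹(x)),
hence (Q′_j(U^u)R(u)λ)(y) = R(u(y))(Q′_j(U)λ)(y), (3.32) and Q′*(U^u)aQ′(U^u) = R(u)Q′*(U)aQ′(U)R(u⁻¹). The equalities (3.31), (3.32) imply
further G′(U^u) = R(u)G′(U)R(u⁻¹), R(U^u) = R(u)R(U)R(u⁻¹). (3.33) Finally inspecting the definitions of the averaging operators Q_j(U) for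
gauge fields we can see that the equalities (3.32) hold again.»*

WHY THIS FILE (cell context).  (3.32)–(3.33) are typed in the tree on the real `ℓ²` (3.25)-carriers (`B9Eq331LatticeCov`, block system abstract) and
for `Q_j(U)` on `ℤ^d` (`B9Eq332FieldAvgCovariance.linCovIter_rot`/`linQcov_rot`).  The NE9 chain's `R(U)`-slot of `Δ_a(U)` (3.26) is
`B9Eq326OperatorAssembly.RofU` — Mathlib's orthogonal projection onto `Δ^η_U N(Q′(U))` for the CONCRETE torus `Q′(U)` of `B9Eq319QprimeTorus` (contours
(1.7) of [B5]) — and its `Q`-slot is the torus reading `B9Eq315QTorus.QtorusW` of the `ℤ^d` linear average through the periodic extension.  This file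
proves their covariance from `B9Eq328GaugeAction` (the derivative letters), the chain property of the torus contours
(`B9Eq319QprimeTorus.isChain_centre_cons_contour`/`getLast_centre_cons_contour`), the projection lemma of ne9-leaf-03 g59
(`B5Eq172FlatFibreNaturality.map_projR_of_intertwine`) and `linQcov_rot` read at the block corners (`B5Eq155FlatAveragingCommute.shift_perSite`).

WHAT IS PROVED (sorry-free; 0 `def`; no inequality of the paper).  For EVERY background `U`, EVERY gauge function `g : TSite → 𝔸ˣ`:
* §1 [folklore] **`pathTr_conj`** (transport along a CHAIN of admissible steps with step maps conjugated by a fibre action is conjugated by the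
  action at the two ends), `stepTransport_gaugeU`, **`QprimeLin_gaugeU`** / **`QprimeW_gaugeU`** = (3.32) ON THE TORUS:
  `(Q′(U^u)R(u)λ)(y) = R(u(L·y))(Q′(U)λ)(y)` — no hypothesis on `g`.
* §2 `inner_AdW_inv` (the inverse gauge function is fibrewise isometric too), **`RofU_gaugeU`** = (3.33b) `R(U^u)R(u) = R(u)R(U)` for the chain's
  projection, given the fibrewise isometry `hAd` of `R(u(x))` (orthogonality is what a projection needs — as `B9Eq333Cov` located).
* §3 `perSite_cornerSite`, **`perCfg_gaugeU`** (the periodic extension intertwines (3.28) on the torus with [B7] (8) on `ℤ^d`, gauge function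
  `g ∘ perSite`), **`hU1_gaugeU`** / **`hreg_gaugeU`** (the DISPLAYED regularity letters of `QtorusW` — unit-boundedness and `α`-regular block contours of
  the extended background — TRANSFER to `U^u` for `u(x) ∈ U1`: `U1` is a subgroup and the contour letter is a closed holonomy, conjugated by (45)),
  `AdA_eq_conjR`, **`QtorusLin_gaugeU`** / **`QtorusW_gaugeU`** = *«(3.32) hold again»* for the torus `Q(U)`: `Q(U^u)R(u)A = R(u₁)Q(U)A`,
  `u₁(y) = u(L·y)` (any regularity witnesses on the two sides — proof-irrelevant).
MODEL / DECLARED READINGS.  (M1) the chain's encodings verbatim (`QprimeW`, `RofU` at `R(U(b))`/`R(U(b)⁻¹)` and scalar `η⁻¹`; `QtorusW` with fine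
weight `c₀`, coarse weight `c₁`, fibre read along `φ`); (M2) DISPLAYED: `hAd` (§2 only), `g(x) ∈ U1` (§3's transfer lemmas only); (M3) NOT HERE:
(3.33a) `G′` (no `G′` letter in the chain), (3.34) (`B9Eq334LaplaceACovariance`), any bound.
HONEST SCOPE.  [folklore] conjugation algebra + one Hilbert-space lemma BY NAME on the cell's own typed carriers realising printed equalities; no
estimate of the paper; NOT summit progress (cell pub-balaban: NE9 NOT PRINTED / NOT PROVED; «NE9 ⇐ the named binders»; spine PROVED 0/9; HONEST
DEPENDENCY: continuum YM on T⁴ ⇐ BetaPertH ∧ nine spine estimates (0/9 proved); BetaPertH ⇐ (D1) ∧ (D4) ∧ CAP+tail; G-an2-4 gates asym, D1 and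
NE2/3/4).  Unit `b2b-balaban-t4-ne9-formalise-leaf-03` (NE9 crux-team leaf prover, gen 60), INTENT I-ne9leaf03-g60-1 file (G2); NEW file importing
`B9Eq330HessianCovariance`, `B5Eq172FlatFibreNaturality`, `B9Eq332FieldAvgCovariance`, `B5Eq155FlatAveragingCommute`; modifies nothing.  Net new
unproved facts: 0.
-/

noncomputable section

open scoped InnerProductSpace ComplexConjugate BigOperators

namespace Literature.MathematicalPhysics.QuantumFieldTheory.Balaban1983to89.B9Eq333ProjectionCovariance

open B9SectCLatticeCarrier (Bond bpos btgt shift unshift)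
open B4Sect5Torus (TSite)
open B9Eq311L2Pairing (WL2)
open B9Eq323Ker (pathTr pathTr_singleton pathTr_cons_cons avgQ)
open B9Eq319QprimeTorus (fineP centre blockCoord blockOf contour stepTransport weight Qprime QprimeLin QprimeLin_apply mem_blockOf_iff
  isChain_centre_cons_contour getLast_centre_cons_contour)
open B11Eq103H1Complex (SiteL2K BondL2K covLaplaceSiteK projR)
open B9Eq310HessianOperator (adTransportW)
open B9Eq326OperatorAssembly (QprimeW RofU)
open B5Eq172FlatFibreNaturality (map_projR_of_intertwine)
open B7Prop1Explicit (U1 Wcx boxVec gaugeAct Wcx_gaugeAct)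
open B7Eq78Linearization (conjR conjR_apply conjR_smul)
open B8Ineq132 (norm_conjR)
open B7Prop3GeneralLinear (linQcov)
open B9Eq332FieldAvgCovariance (linQcov_rot)
open B9Eq315QTorus (perSite perCfg perCfg_apply cornerSite QtorusLin QtorusLin_apply QtorusW QtorusW_apply)
open B5Eq155FlatAveragingCommute (shift_perSite)
open B9Eq328GaugeAction B9Eq330HessianCovariance

variable {d : ℕ}

/-! ## §1 (3.32) on the torus: `(Q′(U^u)R(u)λ)(y) = R(u(L·y))(Q′(U)λ)(y)` -/

section PathTr

variable {X V : Type*} [AddCommGroup V] [Module ℝ V]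

/-- [folklore] **Transport along a chain of admissible steps with CONJUGATED step maps is conjugated at the two ends**: if every admissible step
map satisfies `τ′(x, x′) = A(x) τ(x, x′) B(x′)` with `A(x)`, `B(x)` mutually inverse, then along any chain `[x₀, …, x_n]` of admissible steps
`R′(Γ) = A(x₀) R(Γ) B(x_n)` — print's *«R(U^u(Γ_{y,x})) = R(u(y))R(U(Γ_{y,x}))R(u⁻¹(x))»*. [cite: Balaban1985BackgroundPropagators, (3.32) p.395] -/
theorem pathTr_conj (S : X → X → Prop) (τ τ' : X → X → V →ₗ[ℝ] V) (A B : X → V →ₗ[ℝ] V) (hBA : ∀ x v, B x (A x v) = v)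
    (hAB : ∀ x v, A x (B x v) = v) (hτ' : ∀ x x', S x x' → ∀ v, τ' x x' v = A x (τ x x' (B x' v))) :
    ∀ (x₀ : X) (rest : List X), List.IsChain S (x₀ :: rest) →
      ∀ v, pathTr τ' (x₀ :: rest) v = A x₀ (pathTr τ (x₀ :: rest) (B ((x₀ :: rest).getLast (List.cons_ne_nil _ _)) v))
  | x₀, [], _, v => by rw [pathTr_singleton, pathTr_singleton, LinearMap.id_apply, List.getLast_singleton, LinearMap.id_apply, hAB]
  | x₀, x₁ :: rest, hc, v => by
    have h01 : S x₀ x₁ := (List.isChain_cons_cons.1 hc).1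
    rw [pathTr_cons_cons, pathTr_cons_cons, LinearMap.comp_apply, LinearMap.comp_apply, List.getLast_cons_cons,
      pathTr_conj S τ τ' A B hBA hAB hτ' x₁ rest (List.isChain_cons_cons.1 hc).2 v, hτ' x₀ x₁ h01, hBA]

end PathTr

section Qprime

variable (L : ℕ) [NeZero L] (m : Fin d → ℕ) {𝔸 : Type*} [Ring 𝔸] [Algebra ℂ 𝔸] {W : Type*} [NormedAddCommGroup W] [InnerProductSpace ℂ W]
  (φ : W ≃ₗ[ℂ] 𝔸) (g : TSite d (fineP L m) → 𝔸ˣ) (U : Bond d (fineP L m) → 𝔸ˣ)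

omit [NeZero L] in
/-- **The step transporters of `U^u` along a forward unit bond are conjugated**: `R(U^u(⟨x, x+e_κ⟩)) = R(u(x)) R(U(⟨x, x+e_κ⟩)) R(u(x+e_κ))⁻¹`
for the site-pair datum `B9Eq319QprimeTorus.stepTransport` of (3.19). [cite: Balaban1985BackgroundPropagators, (3.32) p.395] -/
theorem stepTransport_gaugeU (x x' : TSite d (fineP L m)) (h : ∃ κ : Fin d, x' = shift κ x) (v : W) :
    stepTransport L m (fun b => (adTransportW φ (gaugeU g U) b).restrictScalars ℝ) x x' v =
      AdW φ (g x) (stepTransport L m (fun b => (adTransportW φ U b).restrictScalars ℝ) x x' (AdW φ (g x')⁻¹ v)) := by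
  unfold stepTransport
  rw [dif_pos h, dif_pos h, LinearMap.restrictScalars_apply, LinearMap.restrictScalars_apply, adTransportW_gaugeU,
    show (btgt (x, h.choose) : TSite d (fineP L m)) = x' from h.choose_spec.symm]

/-- **(3.32) FOR THE CONCRETE TORUS `Q′(U)` of (3.19)** (`B9Eq319QprimeTorus.QprimeLin` at the transporters read on the fibre):
`(Q′(U^u)R(u)λ)(y) = R(u(L·y))(Q′(U)λ)(y)` — the contours `Γ_{y,x}` run from the block centre `L·y` to `x` along forward unit bonds, so
*«R(U^u(Γ_{y,x})) = R(u(y))R(U(Γ_{y,x}))R(u⁻¹(x))»*. [cite: Balaban1985BackgroundPropagators, (3.32) p.395, (3.19) p.393] -/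
theorem QprimeLin_gaugeU (l : TSite d (fineP L m) → W) (y : TSite d m) :
    QprimeLin L m (adTransportW φ (gaugeU g U)) (fun x => AdW φ (g x) (l x)) y = AdW φ (g (centre L m y)) (QprimeLin L m (adTransportW φ U) l y) := by
  rw [QprimeLin_apply, QprimeLin_apply]
  unfold Qprime avgQ
  rw [map_sum]
  refine Finset.sum_congr rfl fun x hx => ?_
  have hy : blockCoord L m x = y := (mem_blockOf_iff L m y x).1 hx
  have hchain := isChain_centre_cons_contour L m x
  have hlast := getLast_centre_cons_contour L m x
  rw [hy] at hchain hlast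
  rw [LinearMap.map_smul_of_tower,
    pathTr_conj (fun a b : TSite d (fineP L m) => ∃ μ : Fin d, b = shift μ a) _ _ (fun x => (AdW φ (g x)).restrictScalars ℝ)
      (fun x => (AdW φ (g x)⁻¹).restrictScalars ℝ) (fun x v => AdW_inv_apply φ (g x) v) (fun x v => AdW_apply_inv φ (g x) v)
      (fun x x' hxx' v => stepTransport_gaugeU L m φ g U x x' hxx' v) _ _ hchain,
    hlast, LinearMap.restrictScalars_apply, LinearMap.restrictScalars_apply, AdW_inv_apply]

variable {c₀ : ℝ}

/-- **(3.32) FOR THE CHAIN'S `Q′(U)` ON THE WEIGHTED `L²` SPACE** (`B9Eq326OperatorAssembly.QprimeW`): `Q′(U^u)(R(u)λ) = R(u₁)(Q′(U)λ)` with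
`u₁(y) = u(L·y)`. [cite: Balaban1985BackgroundPropagators, (3.32) p.395] -/
theorem QprimeW_gaugeU (f : SiteL2K ℂ d (fineP L m) c₀ W) :
    QprimeW L m φ (gaugeU g U) (gaugeW φ g f) = fun y => AdW φ (g (centre L m y)) (QprimeW L m φ U f y) := by
  funext y
  show QprimeLin L m (adTransportW φ (gaugeU g U)) (WL2.equiv ℂ _ W (gaugeW φ g f)) y =
    AdW φ (g (centre L m y)) (QprimeLin L m (adTransportW φ U) (WL2.equiv ℂ _ W f) y)
  rw [equiv_gaugeW_eq, QprimeLin_gaugeU]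

/-- The kernels correspond: `Q′(U)λ = 0 ↔ Q′(U^u)(R(u)λ) = 0`. [cite: Balaban1985BackgroundPropagators, (3.32) p.395, (3.21) p.394] -/
theorem QprimeW_gaugeU_eq_zero_iff (f : SiteL2K ℂ d (fineP L m) c₀ W) :
    QprimeW L m φ (gaugeU g U) (gaugeW φ g f) = 0 ↔ QprimeW L m φ U f = 0 := by
  rw [QprimeW_gaugeU]
  constructor
  · intro h
    funext y
    have hy := congrFun h y
    simp only [Pi.zero_apply] at hy ⊢
    rw [← AdW_inv_apply φ (g (centre L m y)) (QprimeW L m φ U f y), hy, map_zero]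
  · intro h
    funext y
    simp only [h, Pi.zero_apply, map_zero]

end Qprime

/-! ## §2 (3.33b): `R(U^u)R(u) = R(u)R(U)` for the chain's projection onto `Δ^η_U N(Q′(U))` -/

section Projection

variable (L : ℕ) [NeZero L] (m : Fin d → ℕ) {𝔸 : Type*} [Ring 𝔸] [Algebra ℂ 𝔸] {W : Type*} [NormedAddCommGroup W] [InnerProductSpace ℂ W]
  (φ : W ≃ₗ[ℂ] 𝔸) {c₀ : ℝ} (η : ℝ) {g : TSite d (fineP L m) → 𝔸ˣ} (U : Bond d (fineP L m) → 𝔸ˣ)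

omit [NeZero L] in
/-- If `R(u(x))` is fibrewise isometric, so is `R(u(x)⁻¹) = R(u(x))⁻¹`. [cite: Balaban1985BackgroundPropagators, (3.31) p.395] -/
theorem inner_AdW_inv (hAd : ∀ (x : TSite d (fineP L m)) (v v' : W), ⟪AdW φ (g x) v, AdW φ (g x) v'⟫_ℂ = ⟪v, v'⟫_ℂ)
    (x : TSite d (fineP L m)) (v v' : W) : ⟪AdW φ (g⁻¹ x) v, AdW φ (g⁻¹ x) v'⟫_ℂ = ⟪v, v'⟫_ℂ := by
  rw [← hAd x (AdW φ (g⁻¹ x) v) (AdW φ (g⁻¹ x) v'), Pi.inv_apply, AdW_apply_inv, AdW_apply_inv]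

variable [FiniteDimensional ℂ W] [Fact (0 < c₀)]

/-- **(3.33b) `R(U^u) R(u) = R(u) R(U)`** for the chain's `R(U)` = the orthogonal projection onto `Δ^η_U N(Q′(U))` (`B9Eq326OperatorAssembly.RofU`):
`R(u)` is unitary on the gauge parameters (`hAd`), intertwines `Δ^η_U`/`Δ^η_{U^u}` ((3.31), `B9Eq328GaugeAction.covLaplaceSiteK_gaugeU`) and the
kernels `N(Q′(U))`/`N(Q′(U^u))` ((3.32)), hence the two projections (`B5Eq172FlatFibreNaturality.map_projR_of_intertwine`).
[cite: Balaban1985BackgroundPropagators, (3.33) p.396, (3.21)–(3.22) p.394] -/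
theorem RofU_gaugeU (hAd : ∀ (x : TSite d (fineP L m)) (v v' : W), ⟪AdW φ (g x) v, AdW φ (g x) v'⟫_ℂ = ⟪v, v'⟫_ℂ)
    (v : SiteL2K ℂ d (fineP L m) c₀ W) : RofU L m φ η (gaugeU g U) (gaugeW φ g v) = gaugeW φ g (RofU L m φ η U v) := by
  have hΔ' : ∀ f : SiteL2K ℂ d (fineP L m) c₀ W, gaugeW φ g (covLaplaceSiteK ((η : ℂ))⁻¹ (adTransportW φ U) (adTransportW φ fun b => (U b)⁻¹) f) =
      covLaplaceSiteK ((η : ℂ))⁻¹ (adTransportW φ (gaugeU g U)) (adTransportW φ fun b => (gaugeU g U b)⁻¹) (gaugeW φ g f) :=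
    fun f => (covLaplaceSiteK_gaugeU φ _ g U f).symm
  have hΔ : ∀ a : SiteL2K ℂ d (fineP L m) c₀ W,
      gaugeW φ g⁻¹ (covLaplaceSiteK ((η : ℂ))⁻¹ (adTransportW φ (gaugeU g U)) (adTransportW φ fun b => (gaugeU g U b)⁻¹) a) =
        covLaplaceSiteK ((η : ℂ))⁻¹ (adTransportW φ U) (adTransportW φ fun b => (U b)⁻¹) (gaugeW φ g⁻¹ a) := by
    intro a
    have h := hΔ' (gaugeW φ g⁻¹ a)
    rw [gaugeW_apply_inv] at h
    rw [← h, gaugeW_inv_apply]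
  have hQ' : ∀ f : SiteL2K ℂ d (fineP L m) c₀ W, QprimeW L m φ U f = 0 → QprimeW L m φ (gaugeU g U) (gaugeW φ g f) = 0 :=
    fun f hf => (QprimeW_gaugeU_eq_zero_iff L m φ g U f).2 hf
  have hQ : ∀ a : SiteL2K ℂ d (fineP L m) c₀ W, QprimeW L m φ (gaugeU g U) a = 0 → QprimeW L m φ U (gaugeW φ g⁻¹ a) = 0 := by
    intro a ha
    have h := (QprimeW_gaugeU_eq_zero_iff L m φ g⁻¹ (gaugeU g U) a).2 ha
    rwa [gaugeU_inv_gaugeU] at h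
  have hadj : ∀ (a f : SiteL2K ℂ d (fineP L m) c₀ W), ⟪a, gaugeW φ g f⟫_ℂ = ⟪gaugeW φ g⁻¹ a, f⟫_ℂ := by
    intro a f
    rw [inner_gaugeW_left φ g⁻¹ (inner_AdW_inv L m φ hAd), inv_inv]
  have key := map_projR_of_intertwine
    (covLaplaceSiteK (c₀ := c₀) ((η : ℂ))⁻¹ (adTransportW φ (gaugeU g U)) (adTransportW φ fun b => (gaugeU g U b)⁻¹))
    (QprimeW L m φ (gaugeU g U) (c₀ := c₀))
    (covLaplaceSiteK (c₀ := c₀) ((η : ℂ))⁻¹ (adTransportW φ U) (adTransportW φ fun b => (U b)⁻¹)) (QprimeW L m φ U (c₀ := c₀))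
    (gaugeW φ g⁻¹) (gaugeW φ g) hadj hΔ hΔ' hQ hQ' v
  exact key.symm

/-- (3.33b) in the printed shape `R(U^u) = R(u)R(U)R(u⁻¹)` as an equality of linear maps. [cite: Balaban1985BackgroundPropagators, (3.33) p.396] -/
theorem RofU_gaugeU_conj (hAd : ∀ (x : TSite d (fineP L m)) (v v' : W), ⟪AdW φ (g x) v, AdW φ (g x) v'⟫_ℂ = ⟪v, v'⟫_ℂ) :
    RofU L m φ η (gaugeU g U) (c₀ := c₀) = gaugeW φ g ∘ₗ RofU L m φ η U ∘ₗ gaugeW φ g⁻¹ := by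
  apply LinearMap.ext
  intro v
  rw [LinearMap.comp_apply, LinearMap.comp_apply, ← RofU_gaugeU L m φ η U hAd, gaugeW_apply_inv]

end Projection

/-! ## §3 *«the equalities (3.32) hold again»* for the one-step vector averaging `Q(U)` of the periodic lattice -/

section Qtorus

variable (L : ℕ) [NeZero L] (m : Fin d → ℕ) [∀ i, NeZero (fineP L m i)]

/-- The block corner `L·y ∈ ℤ^d` reads on the fine torus as the block centre. [cite: Balaban1985Averaging, (2) p.17] -/
theorem perSite_cornerSite (y : TSite d m) : perSite (fineP L m) (cornerSite L y) = centre L m y := by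
  funext i
  apply Fin.ext
  have hlt : L * (y i : ℕ) < fineP L m i := Nat.mul_lt_mul_of_pos_left (y i).isLt (Nat.pos_of_ne_zero (NeZero.ne L))
  have hlt' : (L : ℤ) * ((y i : ℕ) : ℤ) < ((fineP L m i : ℕ) : ℤ) := by exact_mod_cast hlt
  have h0 : (0 : ℤ) ≤ (L : ℤ) * ((y i : ℕ) : ℤ) := by positivity
  simp only [perSite, cornerSite, Int.emod_eq_of_lt h0 hlt']
  exact_mod_cast Int.toNat_natCast (L * (y i : ℕ))

variable {G : Type*} [Group G]

omit [NeZero L] in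
/-- **The periodic extension intertwines (3.28) on the torus with [B7] (8) on `ℤ^d`**: `(U^u)~ = (Ũ)^{u ∘ per}` for the gauge function
`x ↦ u(x mod P)`. [cite: Balaban1985BackgroundPropagators, (3.28) p.395; Balaban1985Averaging, (8) p.18, (1) p.17] -/
theorem perCfg_gaugeU (g : TSite d (fineP L m) → G) (U : Bond d (fineP L m) → G) :
    perCfg (fineP L m) (gaugeU g U) = gaugeAct (fun x => g (perSite (fineP L m) x)) (perCfg (fineP L m) U) := by
  funext x κ
  rw [perCfg_apply, gaugeU_apply_dir, shift_perSite]
  rfl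

variable {𝔸 : Type*} [NormedRing 𝔸] [NormedAlgebra ℂ 𝔸] (g : TSite d (fineP L m) → 𝔸ˣ) (U : Bond d (fineP L m) → 𝔸ˣ)

omit [NeZero L] [∀ i, NeZero (fineP L m i)] in
/-- `R(u)X = uXu⁻¹` of `B9Eq328GaugeAction` IS `B7Eq78Linearization.conjR`. [cite: Balaban1985BackgroundPropagators, p.390] -/
theorem AdA_eq_conjR (u : 𝔸ˣ) (X : 𝔸) : AdA u X = conjR u X := by
  rw [AdA_apply, conjR_apply]

variable [NormOneClass 𝔸]

omit [NeZero L] [NormedAlgebra ℂ 𝔸] in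
/-- **THE UNIT-BOUNDEDNESS LETTER OF `QtorusW` TRANSFERS TO `U^u` for `u(x) ∈ U1`** (`U1` is a subgroup of `𝔸ˣ`).
[cite: Balaban1985Averaging, p.24; Balaban1985BackgroundPropagators, (3.28) p.395] -/
theorem hU1_gaugeU (hg : ∀ x, g x ∈ U1 𝔸) (hU1 : ∀ (x : B7Prop1Explicit.Site d) (κ : Fin d), perCfg (fineP L m) U x κ ∈ U1 𝔸)
    (x : B7Prop1Explicit.Site d) (κ : Fin d) : perCfg (fineP L m) (gaugeU g U) x κ ∈ U1 𝔸 := by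
  rw [perCfg_apply, gaugeU_apply]
  exact (U1 𝔸).mul_mem ((U1 𝔸).mul_mem (hg _) (by simpa only [perCfg_apply] using hU1 x κ)) ((U1 𝔸).inv_mem (hg _))

omit [NeZero L] in
/-- **THE BLOCK-CONTOUR REGULARITY LETTER OF `QtorusW` TRANSFERS TO `U^u` for `u(x) ∈ U1`**: the letter is the distance to `1` of a CLOSED
holonomy `V(Γ_{c,x})V(c)⁻¹` ([B7] (42)), conjugated by `u` at the block corner ((45), `B7Prop1Explicit.Wcx_gaugeAct`) — and `‖uYu⁻¹‖ = ‖Y‖` on `U1`.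
[cite: Balaban1985Averaging, (42) p.23, (45) p.24; Balaban1985BackgroundPropagators, (3.28) p.395] -/
theorem hreg_gaugeU (hg : ∀ x, g x ∈ U1 𝔸) {α : ℝ} (hreg : ∀ (y : TSite d m) (κ : Fin d) (r : Fin d → Fin L),
      ‖((Wcx L (perCfg (fineP L m) U) (cornerSite L y) κ (boxVec L r) : 𝔸ˣ) : 𝔸) - 1‖ ≤ α)
    (y : TSite d m) (κ : Fin d) (r : Fin d → Fin L) :
    ‖((Wcx L (perCfg (fineP L m) (gaugeU g U)) (cornerSite L y) κ (boxVec L r) : 𝔸ˣ) : 𝔸) - 1‖ ≤ α := by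
  rw [perCfg_gaugeU, Wcx_gaugeAct, Units.val_mul, Units.val_mul, ← conjR_apply, ← AdA_eq_conjR, AdA_sub_one, AdA_eq_conjR, norm_conjR (hg _)]
  exact hreg y κ r

variable [CompleteSpace 𝔸] (hL : 1 ≤ L) {W : Type*} [NormedAddCommGroup W] [InnerProductSpace ℂ W] (φ : W ≃ₗ[ℂ] 𝔸) {c₀ c₁ : ℝ}
  {α : ℝ} (hα1 : α ≤ 1 / 64)
  (hU1 : ∀ (x : B7Prop1Explicit.Site d) (κ : Fin d), perCfg (fineP L m) U x κ ∈ U1 𝔸)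
  (hreg : ∀ (y : TSite d m) (κ : Fin d) (r : Fin d → Fin L),
    ‖((Wcx L (perCfg (fineP L m) U) (cornerSite L y) κ (boxVec L r) : 𝔸ˣ) : 𝔸) - 1‖ ≤ α)
  (hU1' : ∀ (x : B7Prop1Explicit.Site d) (κ : Fin d), perCfg (fineP L m) (gaugeU g U) x κ ∈ U1 𝔸)
  (hreg' : ∀ (y : TSite d m) (κ : Fin d) (r : Fin d → Fin L),
    ‖((Wcx L (perCfg (fineP L m) (gaugeU g U)) (cornerSite L y) κ (boxVec L r) : 𝔸ˣ) : 𝔸) - 1‖ ≤ α)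

/-- **«(3.32) HOLD AGAIN» FOR THE TORUS `Q(U)` of (3.15)** (`B9Eq315QTorus.QtorusLin`, `𝔸`-valued): `(Q(U^u)R(u)A)(c) = R(u(L·y))(Q(U)A)(c)` for the
coarse bond `c = (y, κ)` — `B9Eq332FieldAvgCovariance.linQcov_rot` on the periodic extensions at the block corner `L·y`. [cite: Balaban1985BackgroundPropagators, (3.32) p.396, (3.15) p.393; Balaban1985Averaging, (124) p.36] -/
theorem QtorusLin_gaugeU (A : Bond d (fineP L m) → 𝔸) (c : Bond d m) :
    QtorusLin L m hL (gaugeU g U) hα1 hU1' hreg' (fun b => conjR (g (bpos b)) (A b)) c =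
      conjR (g (centre L m c.1)) (QtorusLin L m hL U hα1 hU1 hreg A c) := by
  rw [QtorusLin_apply, QtorusLin_apply, perCfg_gaugeU,
    show perCfg (fineP L m) (fun b : Bond d (fineP L m) => conjR (g (bpos b)) (A b)) =
      fun x κ => conjR (g (perSite (fineP L m) x)) (perCfg (fineP L m) A x κ) from rfl,
    linQcov_rot, perSite_cornerSite, conjR_smul]

/-- **«(3.32) HOLD AGAIN» FOR THE CHAIN'S `Q(U)` ON THE WEIGHTED `L²` SPACES** (`B9Eq315QTorus.QtorusW`): `Q(U^u)(R(u)f) = R(u₁)(Q(U)f)`, `u₁(y) = u(L·y)`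
acting at the base point of the coarse bond — whatever regularity witnesses are supplied on the two sides.
[cite: Balaban1985BackgroundPropagators, (3.32) p.396, (3.15) p.393] -/
theorem QtorusW_gaugeU (f : BondL2K ℂ d (fineP L m) c₀ W) :
    QtorusW L m hL φ (gaugeU g U) hα1 hU1' hreg' (c₁ := c₁) (gaugeW φ (fun b : Bond d (fineP L m) => g (bpos b)) f) =
      gaugeW φ (fun c : Bond d m => g (centre L m (bpos c))) (QtorusW L m hL φ U hα1 hU1 hreg (c₁ := c₁) f) := by
  apply (WL2.equiv ℂ (fun _ : Bond d m => c₁) W).injective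
  funext c
  rw [QtorusW_apply, equiv_gaugeW, QtorusW_apply, AdW_apply, LinearEquiv.apply_symm_apply, ← conjR_apply]
  simp only [equiv_gaugeW, apply_AdW, AdA_eq_conjR]
  rw [QtorusLin_gaugeU L m g U hL hα1 hU1 hreg hU1' hreg']

end Qtorus

end Literature.MathematicalPhysics.QuantumFieldTheory.Balaban1983to89.B9Eq333ProjectionCovariance

end
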